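import Summits.HubbardSuperconductivity.HubbardSuperconductivity.Theorems.AnisotropyChordTransferFibre3LemmaVTargets
import Summits.HubbardSuperconductivity.HubbardSuperconductivity.Theorems.AnisotropyChordTransferFibre3GroundState

/-!
# Route `AnisotropyChord` / H0 rotor rung: PartN36 — the FREEZE IDENTITY (V1′) of LEMMA V′ PROVED (`L ≥ 3`)

Theory seat `hubbard-h0-rotor-theory-1` g21, memo ROTOR-THEORY-21 §313(c), typed target `FreezeIdentity`
(`…Fibre3LemmaVTargets`, PORT PartN36).  For `ψ` vanishing on the hard core `D`,
`Re⟨ψ,(H₀^{K₁} − W)ψ⟩` equals the sum of the three «frozen» Dirichlet forms (each ordered bond weight ¼).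

Proof (pure bookkeeping of `H0apply`/`Wcount`):
* `gsq_pointwise` / `re_hop_eq`: one directed hop `c ↦ c + w` with unit phase `φ`:
  `Re Σ_c conj(ψ c)·φ·ψ(c+w) = ½Σ|ψ c|²(1 − [c+w ∈ D]) + ½Σ|ψ c|²(1 − [c−w ∈ D]) − ½ Σ_c [c,c+w ∉ D]‖ψ c − φψ(c+w)‖²`
  (polarisation + translation reindexing; the exact form of the inequality `re_hop_le` of `…Fibre3Dirichlet`);
* `re_ip_H0apply_eq_cnt`: summing the three hop types and four directions,
  `Re⟨ψ,H₀ψ⟩ = ½ Σ_c cnt(c)|ψ c|² + ¼ Σ (guarded squares)` — valid for EVERY `L`;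
* `cnt_eq_two_Wcount` (`L ≥ 3`, off `D`): the number of hops into `D` is exactly `2·W(c)` (the inequality
  `two_Wcount_le_cnt` of `…Fibre3Shell` is an equality once `±eₓ, ±e_y` are pairwise distinct);
* `freezeIdentity_holds (hL : 3 ≤ L) : FreezeIdentity L`.
REMARK: at `L = 2` the identity is FALSE as typed (`nnList` lists every neighbour twice, `cnt = 4W`), hence the
hypothesis `3 ≤ L`; downstream (`SecondGapK1OfHole75`) only `L ≥ 4` is used.
Prover seat `hubbard-h0-rotor-p1` g23; helper for stmt-HubbardSuperconductivity-19089 (`--supports`).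
-/

set_option linter.dupNamespace false
set_option autoImplicit false

noncomputable section

open scoped BigOperators
open Complex

namespace Summit.HubbardSuperconductivity.HubbardSuperconductivity.Theorems.AnisotropyChord.Transfer.Fibre3

variable (L : ℕ) [NeZero L]

/-! ## One directed hop: the exact polarisation identity -/

/-- guarded hop square `[c ∉ D][c + w ∉ D]·‖Y c − φ·Y(c + w)‖²`. [folklore] -/
def gsq (Y : Cfg L → ℂ) (w : Cfg L) (φ : ℂ) (c : Cfg L) : ℝ :=
  if (InD L c = true ∨ InD L (c + w) = true) then 0 else ‖Y c - φ * Y (c + w)‖ ^ 2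

omit [NeZero L] in
/-- `‖u − v‖² = ‖u‖² + ‖v‖² − 2·Re(conj u · v)` in `ℂ`. [folklore] -/
theorem norm_sub_sq_conj (u v : ℂ) : ‖u - v‖ ^ 2 = ‖u‖ ^ 2 + ‖v‖ ^ 2 - 2 * ((starRingEnd ℂ) u * v).re := by
  rw [← Complex.normSq_eq_norm_sq, ← Complex.normSq_eq_norm_sq, ← Complex.normSq_eq_norm_sq, Complex.normSq_sub]
  have : (u * (starRingEnd ℂ) v).re = ((starRingEnd ℂ) u * v).re := by
    rw [← Complex.conj_re (u * (starRingEnd ℂ) v), map_mul, Complex.conj_conj]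
  rw [this]

omit [NeZero L] in
/-- **pointwise polarisation** for `Y` vanishing on `D` and a unit phase `φ`:
`gsq = |Y c|²(1 − [c+w ∈ D]) + |Y(c+w)|²(1 − [c ∈ D]) − 2 Re(conj(Y c)·φ·Y(c+w))`. [folklore] -/
theorem gsq_pointwise (Y : Cfg L → ℂ) (hY : ∀ c, InD L c = true → Y c = 0) (w : Cfg L) (φ : ℂ) (hφ : ‖φ‖ = 1)
    (c : Cfg L) :
    gsq L Y w φ c = ‖Y c‖ ^ 2 * (1 - Dind L (c + w)) + ‖Y (c + w)‖ ^ 2 * (1 - Dind L c)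
      - 2 * ((starRingEnd ℂ) (Y c) * (φ * Y (c + w))).re := by
  unfold gsq
  by_cases h1 : InD L c = true
  · rw [if_pos (Or.inl h1), hY _ h1, Dind_eq_one_of L h1]; simp
  · by_cases h2 : InD L (c + w) = true
    · rw [if_pos (Or.inr h2), hY _ h2, Dind_eq_one_of L h2]; simp
    · rw [if_neg (not_or.mpr ⟨h1, h2⟩)]
      have e1 : Dind L (c + w) = 0 := by unfold Dind; simp [h2]
      have e2 : Dind L c = 0 := by unfold Dind; simp [h1]
      rw [e1, e2, norm_sub_sq_conj, norm_mul, hφ, one_mul]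
      ring

/-- **one directed hop, exactly:** for `Y` vanishing on `D`, a translation `w` and a unit phase `φ`,
`Re Σ_c conj(Y c)·φ·Y(c+w) = ½Σ|Y c|²(1 − [c+w ∈ D]) + ½Σ|Y c|²(1 − [c−w ∈ D]) − ½ Σ_c gsq`. [folklore] -/
theorem re_hop_eq (Y : Cfg L → ℂ) (hY : ∀ c, InD L c = true → Y c = 0) (w : Cfg L) (φ : ℂ) (hφ : ‖φ‖ = 1) :
    (∑ c : Cfg L, (starRingEnd ℂ) (Y c) * (φ * Y (c + w))).re
      = (1 / 2) * ∑ c : Cfg L, ‖Y c‖ ^ 2 * (1 - Dind L (c + w))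
        + (1 / 2) * ∑ c : Cfg L, ‖Y c‖ ^ 2 * (1 - Dind L (c - w))
        - (1 / 2) * ∑ c : Cfg L, gsq L Y w φ c := by
  have hre : ∑ c : Cfg L, ‖Y (c + w)‖ ^ 2 * (1 - Dind L c) = ∑ c : Cfg L, ‖Y c‖ ^ 2 * (1 - Dind L (c - w)) := by
    refine Fintype.sum_equiv (Equiv.addRight w) _ _ fun c => ?_
    simp only [Equiv.coe_addRight, add_sub_cancel_right]
  have hs : ∑ c : Cfg L, gsq L Y w φ c
      = ∑ c : Cfg L, ‖Y c‖ ^ 2 * (1 - Dind L (c + w)) + ∑ c : Cfg L, ‖Y c‖ ^ 2 * (1 - Dind L (c - w))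
        - 2 * (∑ c : Cfg L, (starRingEnd ℂ) (Y c) * (φ * Y (c + w))).re := by
    rw [← hre, Complex.re_sum, Finset.mul_sum, ← Finset.sum_add_distrib, ← Finset.sum_sub_distrib]
    refine Finset.sum_congr rfl fun c _ => ?_
    exact gsq_pointwise L Y hY w φ hφ c
  rw [hs]; ring

/-! ## Summing the three hop types and the four directions -/

/-- the three guarded squares of direction `e`: straight hops `(e,0)`, `(0,e)` and the twisted diagonal hop `(−e,−e)`. [folklore] -/
def gsq3 (Y : Cfg L → ℂ) (e : Tor L) (c : Cfg L) : ℝ :=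
  gsq L Y (e, 0) 1 c + gsq L Y (0, e) 1 c + gsq L Y (-e, -e) (phase L (K1 L) e) c

/-- the real part of a directional hopping form, exactly: `Re hopSum e = ½Σ|Y|²·wt e − ½Σ gsq3 e`. [folklore] -/
theorem re_hopSum_eq (Y : Cfg L → ℂ) (hY : ∀ c, InD L c = true → Y c = 0) (e : Tor L) :
    (hopSum L (K1 L) Y Y e).re
      = (1 / 2) * ∑ c : Cfg L, ‖Y c‖ ^ 2 * wt L e c - (1 / 2) * ∑ c : Cfg L, gsq3 L Y e c := by
  unfold hopSum
  have p1 : ∀ c : Cfg L, (c.1 + e, c.2) = c + (e, 0) := fun c => by ext <;> simp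
  have p2 : ∀ c : Cfg L, (c.1, c.2 + e) = c + (0, e) := fun c => by ext <;> simp
  have p3 : ∀ c : Cfg L, (c.1 - e, c.2 - e) = c + (-e, -e) := fun c => by ext <;> simp [sub_eq_add_neg]
  simp_rw [p1, p2, p3, mul_add, Finset.sum_add_distrib, Complex.add_re]
  have h1 := re_hop_eq L Y hY ((e, 0) : Cfg L) 1 (by simp)
  have h2 := re_hop_eq L Y hY ((0, e) : Cfg L) 1 (by simp)
  have h3 := re_hop_eq L Y hY ((-e, -e) : Cfg L) (phase L (K1 L) e) (norm_phase L (K1 L) e)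
  simp only [one_mul] at h1 h2
  have hw : ∑ c : Cfg L, ‖Y c‖ ^ 2 * wt L e c
      = (∑ c : Cfg L, ‖Y c‖ ^ 2 * (1 - Dind L (c + (e, 0))) + ∑ c : Cfg L, ‖Y c‖ ^ 2 * (1 - Dind L (c - (e, 0))))
        + (∑ c : Cfg L, ‖Y c‖ ^ 2 * (1 - Dind L (c + (0, e))) + ∑ c : Cfg L, ‖Y c‖ ^ 2 * (1 - Dind L (c - (0, e))))
        + (∑ c : Cfg L, ‖Y c‖ ^ 2 * (1 - Dind L (c + (-e, -e)))
            + ∑ c : Cfg L, ‖Y c‖ ^ 2 * (1 - Dind L (c - (-e, -e)))) := by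
    unfold wt; simp only [mul_add, Finset.sum_add_distrib]
  have hg : ∑ c : Cfg L, gsq3 L Y e c
      = ∑ c : Cfg L, gsq L Y (e, 0) 1 c + ∑ c : Cfg L, gsq L Y (0, e) 1 c
        + ∑ c : Cfg L, gsq L Y (-e, -e) (phase L (K1 L) e) c := by
    unfold gsq3; rw [Finset.sum_add_distrib, Finset.sum_add_distrib]
  have h1' : (∑ c : Cfg L, (starRingEnd ℂ) (Y c) * Y (c + (e, 0))).re
      = (1 / 2) * ∑ c : Cfg L, ‖Y c‖ ^ 2 * (1 - Dind L (c + (e, 0)))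
        + (1 / 2) * ∑ c : Cfg L, ‖Y c‖ ^ 2 * (1 - Dind L (c - (e, 0)))
        - (1 / 2) * ∑ c : Cfg L, gsq L Y (e, 0) 1 c := by
    rw [← h1]
  have h2' : (∑ c : Cfg L, (starRingEnd ℂ) (Y c) * Y (c + (0, e))).re
      = (1 / 2) * ∑ c : Cfg L, ‖Y c‖ ^ 2 * (1 - Dind L (c + (0, e)))
        + (1 / 2) * ∑ c : Cfg L, ‖Y c‖ ^ 2 * (1 - Dind L (c - (0, e)))
        - (1 / 2) * ∑ c : Cfg L, gsq L Y (0, e) 1 c := by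
    rw [← h2]
  rw [hw, hg, h1', h2', h3]; ring

/-- **the hopping form as «hops into `D`» plus frozen Dirichlet forms** (every `L`): for `Y` vanishing on `D`,
`Re⟨Y, H₀Y⟩ = ½ Σ_c cnt(c)|Y c|² + ¼ Σ_c Σ_{e = ±eₓ,±e_y} gsq3 e c`. [folklore] -/
theorem re_ip_H0apply_eq_cnt (Y : Cfg L → ℂ) (hY : ∀ c, InD L c = true → Y c = 0) :
    (ip L Y (H0apply L (K1 L) Y)).re
      = (1 / 2) * ∑ c : Cfg L, cnt L c * ‖Y c‖ ^ 2
        + (1 / 4) * ∑ c : Cfg L, (gsq3 L Y (ex L) c + gsq3 L Y (-ex L) c + gsq3 L Y (ey L) c + gsq3 L Y (-ey L) c) := by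
  rw [ip_H0apply]
  have hN : (ip L Y Y).re = ∑ c : Cfg L, ‖Y c‖ ^ 2 := ip_self_re L Y
  have h1 := re_hopSum_eq L Y hY (ex L)
  have h2 := re_hopSum_eq L Y hY (-ex L)
  have h3 := re_hopSum_eq L Y hY (ey L)
  have h4 := re_hopSum_eq L Y hY (-ey L)
  have key : ∑ c : Cfg L, ‖Y c‖ ^ 2 * wt L (ex L) c + ∑ c : Cfg L, ‖Y c‖ ^ 2 * wt L (-ex L) c
      + ∑ c : Cfg L, ‖Y c‖ ^ 2 * wt L (ey L) c + ∑ c : Cfg L, ‖Y c‖ ^ 2 * wt L (-ey L) c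
      = 24 * ∑ c : Cfg L, ‖Y c‖ ^ 2 - 2 * ∑ c : Cfg L, cnt L c * ‖Y c‖ ^ 2 := by
    rw [← Finset.sum_add_distrib, ← Finset.sum_add_distrib, ← Finset.sum_add_distrib, Finset.mul_sum, Finset.mul_sum,
      ← Finset.sum_sub_distrib]
    refine Finset.sum_congr rfl fun c _ => ?_
    have := wt_sum_eq L c
    calc ‖Y c‖ ^ 2 * wt L (ex L) c + ‖Y c‖ ^ 2 * wt L (-ex L) c + ‖Y c‖ ^ 2 * wt L (ey L) c
          + ‖Y c‖ ^ 2 * wt L (-ey L) c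
        = ‖Y c‖ ^ 2 * (wt L (ex L) c + wt L (-ex L) c + wt L (ey L) c + wt L (-ey L) c) := by ring
      _ = 24 * ‖Y c‖ ^ 2 - 2 * (cnt L c * ‖Y c‖ ^ 2) := by rw [this]; ring
  have hG : ∑ c : Cfg L, (gsq3 L Y (ex L) c + gsq3 L Y (-ex L) c + gsq3 L Y (ey L) c + gsq3 L Y (-ey L) c)
      = ∑ c : Cfg L, gsq3 L Y (ex L) c + ∑ c : Cfg L, gsq3 L Y (-ex L) c + ∑ c : Cfg L, gsq3 L Y (ey L) c
        + ∑ c : Cfg L, gsq3 L Y (-ey L) c := by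
    rw [Finset.sum_add_distrib, Finset.sum_add_distrib, Finset.sum_add_distrib]
  have eH : (6 * ip L Y Y - (1 / 2 : ℂ) * (hopSum L (K1 L) Y Y (ex L) + hopSum L (K1 L) Y Y (-ex L)
      + hopSum L (K1 L) Y Y (ey L) + hopSum L (K1 L) Y Y (-ey L))).re
      = 6 * ∑ c : Cfg L, ‖Y c‖ ^ 2 - (1 / 2) * ((hopSum L (K1 L) Y Y (ex L)).re + (hopSum L (K1 L) Y Y (-ex L)).re
          + (hopSum L (K1 L) Y Y (ey L)).re + (hopSum L (K1 L) Y Y (-ey L)).re) := by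
    rw [← hN]; simp only [Complex.sub_re, Complex.mul_re, Complex.add_re]; norm_num
  rw [eH, hG, h1, h2, h3, h4]
  linarith

/-! ## Off the hard core the number of hops into `D` is exactly `2·W` (`L ≥ 3`) -/

omit [NeZero L] in
/-- membership in the hard core, spelled out: `(a,b) ∈ D ⟺ a = 0 ∨ b = 0 ∨ a = b`. [folklore] -/
theorem inD_iff (a b : Tor L) : InD L (a, b) = true ↔ (a = 0 ∨ b = 0 ∨ a = b) := by
  unfold InD; simp only [Bool.or_eq_true, decide_eq_true_eq]; tauto

/-- **two marked slots, exactly** (`L ≥ 3`): if `x ≠ y` and `t e = [e = x ∨ e = y]`, then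
`t(eₓ) + t(−eₓ) + t(e_y) + t(−e_y) = [x nn] + [y nn]`. [folklore] -/
theorem count2_eq (hL : 3 ≤ L) (t : Tor L → ℝ) {x y : Tor L} (hxy : x ≠ y)
    (ht : ∀ e, t e = if (e = x ∨ e = y) then 1 else 0) :
    t (ex L) + t (-ex L) + t (ey L) + t (-ey L)
      = (if IsNN L x = true then 1 else 0 : ℝ) + (if IsNN L y = true then 1 else 0 : ℝ) := by
  classical
  obtain ⟨d1, d2, d3, d4, d5, d6⟩ := nn_distinct L hL
  -- the four-term sum as a sum over the four-element set of nearest-neighbour vectors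
  have hS : t (ex L) + t (-ex L) + t (ey L) + t (-ey L)
      = ∑ e ∈ ({ex L, -ex L, ey L, -ey L} : Finset (Tor L)), t e := by
    rw [Finset.sum_insert (by simp [d1, d2, d3]), Finset.sum_insert (by simp [d4, d5]),
      Finset.sum_insert (by simp [d6]), Finset.sum_singleton]
    ring
  -- since `x ≠ y`, the indicator of `{x, y}` splits
  have hsplit : ∀ e, t e = (if e = x then 1 else 0 : ℝ) + (if e = y then 1 else 0 : ℝ) := by
    intro e
    rw [ht]
    by_cases hx : e = x
    · subst hx
      simp [hxy]
    · by_cases hy : e = y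
      · subst hy
        simp [hx]
      · simp [hx, hy]
  rw [hS, Finset.sum_congr rfl (fun e _ => hsplit e), Finset.sum_add_distrib, Finset.sum_ite_eq',
    Finset.sum_ite_eq', ← filter_isNN]
  simp only [Finset.mem_filter, Finset.mem_univ, true_and]

omit [NeZero L] in
/-- the two slots of a straight hop: `a + e = 0 ∨ a + e = b ⟺ e = −a ∨ e = b − a`. [folklore] -/
theorem slot_iff (a b e : Tor L) : (a + e = 0 ∨ a + e = b) ↔ (e = -a ∨ e = b - a) := by
  constructor
  · rintro (h | h)
    · left; exact (neg_eq_of_add_eq_zero_right h).symm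
    · right; rw [← h]; abel
  · rintro (rfl | rfl)
    · left; exact add_neg_cancel a
    · right; abel

/-- **off the hard core, `cnt(c) = 2·W(c)`** (`L ≥ 3`): each nearest-neighbour pair among the three particles gives exactly
two hops into `D`, and no other hop lands in `D`. [folklore] -/
theorem cnt_eq_two_Wcount (hL : 3 ≤ L) (c : Cfg L) (hc : InD L c = false) : cnt L c = 2 * (Wcount L c : ℝ) := by
  obtain ⟨a, b⟩ := c
  have hD : ¬ (a = 0 ∨ b = 0 ∨ a = b) := fun h => by
    have := (inD_iff L a b).2 h; rw [hc] at this; exact Bool.false_ne_true this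
  have ha : a ≠ 0 := fun h => hD (Or.inl h)
  have hb : b ≠ 0 := fun h => hD (Or.inr (Or.inl h))
  have hab : a ≠ b := fun h => hD (Or.inr (Or.inr h))
  -- type-1 hops `(a+e, b)`: slots `e = −a` and `e = b − a`
  have T1 := count2_eq L hL (fun e => Dind L (((a, b) : Cfg L) + (e, 0))) (x := -a) (y := b - a)
    (by intro h; apply hb; have h2 : b = (b - a) + a := (sub_add_cancel b a).symm
        rw [← h, neg_add_cancel] at h2; exact h2)
    (by intro e
        unfold Dind
        simp only [Prod.mk_add_mk, add_zero, inD_iff, hb, false_or, slot_iff])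
  -- type-2 hops `(a, b+e)`: slots `e = −b` and `e = a − b`
  have T2 := count2_eq L hL (fun e => Dind L (((a, b) : Cfg L) + (0, e))) (x := -b) (y := a - b)
    (by intro h; apply ha; have h2 : a = (a - b) + b := (sub_add_cancel a b).symm
        rw [← h, neg_add_cancel] at h2; exact h2)
    (by intro e
        unfold Dind
        have hiff : (a = 0 ∨ b + e = 0 ∨ a = b + e) ↔ (e = -b ∨ e = a - b) := by
          rw [← slot_iff]; constructor
          · rintro (h | h | h)
            · exact (ha h).elim
            · exact Or.inl h
            · exact Or.inr h.symm
          · rintro (h | h)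
            · exact Or.inr (Or.inl h)
            · exact Or.inr (Or.inr h.symm)
        simp only [Prod.mk_add_mk, add_zero, inD_iff, hiff])
  -- type-3 hops `(a−e, b−e)`: slots `e = a` and `e = b`
  have T3 := count2_eq L hL (fun e => Dind L (((a, b) : Cfg L) + (-e, -e))) (x := a) (y := b) hab
    (by intro e
        unfold Dind
        have hiff : (a + -e = 0 ∨ b + -e = 0 ∨ a + -e = b + -e) ↔ (e = a ∨ e = b) := by
          constructor
          · rintro (h | h | h)
            · left; rw [← sub_eq_add_neg, sub_eq_zero] at h; exact h.symm
            · right; rw [← sub_eq_add_neg, sub_eq_zero] at h; exact h.symm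
            · exact (hab (add_right_cancel h)).elim
          · rintro (rfl | rfl)
            · left; exact add_neg_cancel _
            · right; left; exact add_neg_cancel _
        simp only [Prod.mk_add_mk, inD_iff, hiff])
  simp only [IsNN_neg] at T1 T2
  rw [← neg_sub b a, IsNN_neg] at T2
  simp only [neg_neg] at T3
  unfold cnt
  simp only [Wcount, Nat.cast_add, Nat.cast_ite, Nat.cast_one, Nat.cast_zero]
  linarith

/-! ## The freeze identity -/

/-- **(V1′) `FreezeIdentity` holds for every `L ≥ 3`:** for `ψ` vanishing on the hard core,
`Re⟨ψ,(H₀^{K₁} − W)ψ⟩ = ¼ Σ_c Σ_e (three guarded squared differences)`. [folklore] -/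
theorem freezeIdentity_holds (hL : 3 ≤ L) : FreezeIdentity L := by
  intro ψ hψ
  rw [re_ip_Happly, re_ip_H0apply_eq_cnt L ψ hψ]
  have hcW : ∑ c : Cfg L, cnt L c * ‖ψ c‖ ^ 2 = 2 * ∑ c : Cfg L, (Wcount L c : ℝ) * ‖ψ c‖ ^ 2 := by
    rw [Finset.mul_sum]
    refine Finset.sum_congr rfl fun c _ => ?_
    by_cases hc : InD L c = true
    · rw [hψ c hc]; simp
    · rw [cnt_eq_two_Wcount L hL c (by simpa using hc)]; ring
  rw [hcW]
  have hF : ∀ (c : Cfg L) (e : Tor L),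
      ((if (InD L c = true ∨ InD L (c.1 + e, c.2) = true) then (0 : ℝ) else ‖ψ c - ψ (c.1 + e, c.2)‖ ^ 2)
        + (if (InD L c = true ∨ InD L (c.1, c.2 + e) = true) then (0 : ℝ) else ‖ψ c - ψ (c.1, c.2 + e)‖ ^ 2)
        + (if (InD L c = true ∨ InD L (c.1 - e, c.2 - e) = true) then (0 : ℝ)
            else ‖ψ c - phase L (K1 L) e * ψ (c.1 - e, c.2 - e)‖ ^ 2))
      = gsq3 L ψ e c := by
    intro c e
    have p1 : (c.1 + e, c.2) = c + (e, 0) := by ext <;> simp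
    have p2 : (c.1, c.2 + e) = c + (0, e) := by ext <;> simp
    have p3 : (c.1 - e, c.2 - e) = c + (-e, -e) := by ext <;> simp [sub_eq_add_neg]
    unfold gsq3 gsq
    rw [p1, p2, p3]; simp only [one_mul]
  simp_rw [hF, nnList_map_sum]
  ring

end Summit.HubbardSuperconductivity.HubbardSuperconductivity.Theorems.AnisotropyChord.Transfer.Fibre3

end
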